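import Summits.QuantumFields.BalabanUV.Beta.D1BFx.GhostHalfStencil
import Summits.QuantumFields.BalabanUV.Beta.D1BFx.TorusHalfWordArrays

/-!
# `BalabanUV.Beta.D1BFx.GhostHalfBridge` — road «BF-x», slot (K): the END-side half-word stencils (`GhostHalfStencil`, (K2) FILE 1) ARE the
# dictionary-side half-word arrays (`TorusHalfWordArrays`, leaf-03-g9 «HALF-WORD ARRAYS»)

Two seats transcribed the same half word `Xh_b = −Ê_bᵀD̂ = E_tu − E_tt` into `MKer 4 Unit` on the same day (K-END-RECUT-SPEC v1 §2∕§4):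
`GhostHalfStencil.xhSt κ u` (END currency, weights `XhS cK`, `Xh2 cW`) and `TorusHalfWordArrays.Xh κ u := −etD κ u` (array currency, `Xh₂`).
This file records, once, that they coincide — so the ghost-array identity (dictionary) and the re-cut END (K6) speak about the same `ℤ⁴`
families: `xhSt_eq_Xh`, `XhS_eq_smul_Xh`, `Xh2_eq_smul_Xh₂`.  [folklore] pointwise case splits; 0 `def`, nothing cited, 0 sorry.
Owner b2b-balaban-beta-d1-p2 (gen 7).  NOT D1, NOT BetaPertH, NOT continuum, NOT Clay.
-/

namespace Summit.QuantumFields.BalabanUV.Beta.D1BFx.GhostHalfBridge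

open Literature.MathematicalPhysics.QuantumFieldTheory.Balaban1983to89
open Literature.MathematicalPhysics.QuantumFieldTheory.Balaban1983to89.Beta
open ExpKernelCalculus (Site MKer)
open AffineAveraging (unitVec)
open Summit.QuantumFields.BalabanUV.Beta.D1BFx.GhostHalfStencil (xhSt xhSt_apply XhS XhS_apply Xh2 Xh2_apply)
open Summit.QuantumFields.BalabanUV.Beta.D1BFx.TorusHalfWordArrays (Xh Xh₂ Xh_apply)
open Summit.QuantumFields.BalabanUV.Beta.D1BFx.TorusGhostWordArrays (etD etD_apply)

noncomputable section

variable (κ : Fin 4) (u : Site 4)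

/-- [folklore] **THE TWO HALF WORDS COINCIDE**: `GhostHalfStencil.xhSt κ u = TorusHalfWordArrays.Xh κ u` (`= −etD κ u`). -/
theorem xhSt_eq_Xh : xhSt κ u = Xh κ u := by
  funext x z a b
  rw [xhSt_apply]
  show _ = -(etD κ u x z a b)
  rw [etD_apply]
  ring

/-- [folklore] The weighted first-order END family is a scalar multiple of the array family: `XhS cK κ u = cK • Xh κ u`. -/
theorem XhS_eq_smul_Xh (cK : ℝ) : XhS cK κ u = cK • Xh κ u := by
  funext x z a b
  rw [XhS_apply, xhSt_eq_Xh]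
  rfl

/-- [folklore] The weighted pure-second END family is a scalar multiple of the array family: `Xh2 cW κ u l u′ = cW • Xh₂ κ u l u′`
(`Xh2`'s test is `κ = l ∧ u = u′`, `Xh₂`'s is `u = u′ ∧ κ = l`; `−cW·xhSt = cW·etD`). -/
theorem Xh2_eq_smul_Xh₂ (cW : ℝ) (l : Fin 4) (u' : Site 4) : Xh2 cW κ u l u' = cW • Xh₂ κ u l u' := by
  funext x z a b
  rw [Xh2_apply, xhSt_eq_Xh]
  show _ = cW * (if u = u' ∧ κ = l then etD κ u else 0) x z a b
  by_cases h : κ = l ∧ u = u'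
  · rw [if_pos h, if_pos ⟨h.2, h.1⟩]
    show -(cW * -(etD κ u x z a b)) = _
    ring
  · rw [if_neg h, if_neg (fun h' => h ⟨h'.2, h'.1⟩)]
    show (0 : ℝ) = cW * 0
    ring

end

end Summit.QuantumFields.BalabanUV.Beta.D1BFx.GhostHalfBridge
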